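import Summits.Schanuel.Schanuel.Theorems.ZilberEacComplexQuadricEscapePowers
import HarnessLib

/-!
# EC vocabulary for the monomial-fibre quadric escape theorem

`quadricEscapePowers_inter_expGraph_nonempty`: the `(s+1)`-folds
`V = {xₙ = xᵀMx + b·x + c₀, yⱼ = cⱼ yₙ^{κⱼ} + Aⱼ(x') (j ≤ s)} ⊆ ℂⁿ × ℂⁿ` (`κⱼ ≥ 1`, `Σᵢⱼ Mᵢⱼκᵢκⱼ ≠ 0`,
`cⱼ ≠ 0`, `Aⱼ` arbitrary) meet `Literature.NumberTheory.Transcendental.expGraph ℂ n` — the set-builder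
form of `exists_expPoint_quadricEscape_powers` (`ZilberEacComplexQuadricEscapePowers.lean`). First open
rung of EAC (`dim π₁ V = n - 1`): Mantova–Masser, PLMS 129 (2024), §1 p. 5.
HONEST FRAMING: a modest sub-rung of EAC; nothing here bears on Schanuel's conjecture.
-/

noncomputable section

open Complex MvPolynomial Metric Set Filter Topology

set_option linter.dupNamespace false

namespace Summit.Schanuel.Schanuel.Theorems

/-- **The monomial-fibre quadric escape varieties meet the graph of exponentiation** (EC
vocabulary): with `n = s + 1`, for positive integers `κⱼ` with `Σᵢⱼ Mᵢⱼ κᵢκⱼ ≠ 0`, `cⱼ ≠ 0` and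
arbitrary `Aⱼ`, the subvariety
`V = {xₙ = Σᵢⱼ Mᵢⱼ xᵢxⱼ + Σᵢ bᵢ xᵢ + c₀, yⱼ = cⱼ yₙ^{κⱼ} + Aⱼ(x') (j ≤ s)}` of `ℂⁿ × ℂⁿ` (distinguished
last coordinate `Fin.last s`) contains a point of `Literature.NumberTheory.Transcendental.expGraph ℂ n`;
no condition on lattice directions. [cite: MantovaMasser2023, §1 p.5 (the open case dim π(V) = 2 in ℂ³×ℂˣ³)] -/
theorem quadricEscapePowers_inter_expGraph_nonempty {s : ℕ} (M : Fin s → Fin s → ℂ) (b : Fin s → ℂ)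
    (c₀ : ℂ) (κ : Fin s → ℕ) (hκ : ∀ j, 0 < κ j) (hα : ∑ i, ∑ j, M i j * (κ i : ℂ) * (κ j : ℂ) ≠ 0)
    (c : Fin s → ℂ) (hc : ∀ j, c j ≠ 0) (A : Fin s → MvPolynomial (Fin s) ℂ) :
    ({z : Fin (s + 1) ⊕ Fin (s + 1) → ℂ |
        z (Sum.inl (Fin.last s)) = ∑ i, ∑ l, M i l * z (Sum.inl (Fin.castSucc i)) * z (Sum.inl (Fin.castSucc l)) +
          ∑ i, b i * z (Sum.inl (Fin.castSucc i)) + c₀ ∧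
        ∀ j : Fin s, z (Sum.inr (Fin.castSucc j)) =
          c j * z (Sum.inr (Fin.last s)) ^ (κ j) + eval (fun i => z (Sum.inl (Fin.castSucc i))) (A j)} ∩
      Literature.NumberTheory.Transcendental.expGraph ℂ (s + 1)).Nonempty := by
  obtain ⟨x, hx⟩ := exists_expPoint_quadricEscape_powers M b c₀ κ hκ hα c hc A
  set X : Fin (s + 1) → ℂ := Fin.snoc x (∑ i, ∑ l, M i l * x i * x l + ∑ i, b i * x i + c₀) with hX
  refine ⟨Sum.elim X fun i => exp (X i), ⟨?_, fun j => ?_⟩, fun i => ?_⟩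
  · simp only [Sum.elim_inl, hX, Fin.snoc_last, Fin.snoc_castSucc]
  · simp only [Sum.elim_inl, Sum.elim_inr, hX, Fin.snoc_castSucc, Fin.snoc_last]
    exact hx j
  · simp [Literature.ModelTheory.ExponentialFields.ExponentialRing.complex_exp_eq]

end Summit.Schanuel.Schanuel.Theorems
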